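import Summits.QuantumFields.YangMills.Theorems.BalabanUVNodesN07Thm4RecordStructureDbar
import Summits.QuantumFields.YangMills.Theorems.BalabanUVNodesN07NormalisationSymOfRecord
import HarnessLib
/-!
# N07 [B11] (= [15] = [Balaban1985Variational]) Sect. F — **THE PREMISE OF RECORD UNDER A3⁵ = ρ3 «φ-FORM», (152)-COMPLETE**: `HThm4RecSym152` = MODULE 88″'s `HThm4RecDbar` rows 1–8
# VERBATIM ∧ print's (152) SECOND member (T2b) `‖∇^η_νA_μ‖ < κ·ε_j·L^{2(j−j′)}` on the dpairs of every `π″□_{j′}` (⚑ LOCATED-DPRIME-T2-GRADIENT, repair (R-a): [15] p.301 L29–30, [6]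
# Prop. 6 (1.136)₂ p.99) ∧ row 9′ := MODULE 87's `NrmSymOfRecord` (S3's gauge read on the representative's tower keyed on the Federbush-AVERAGED axial datum of [I] (0.11); plan g93
# WORD A3⁵ I.30116: «row 9 of the N07 head's Thm-4 premise := `NrmSymOfRecord` + the φ-letter; 91″ `NrmSymOfRecord` and 88″'s ninth conjunct REST»); monotonicity; the door
# S1ᶜ to the (152)-complete HS3NORM clause at `Nrm := NrmSymOfRecord`; the A6 certificates at the trivial field

Cell `pub-ymgap`, seat `pub-ymgap-dag-n07-e` g30 (FAN-OUT §N07 row s3; LANE OWNER of the K0 road chart side) — plan g93 WORD (c-ii).  `--kind definition --supports stmt-QuantumFields-20541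
--as helper` (K0⁷); count-neutral.  ONE `def` (a displayed premise, NEVER asserted) + bookkeeping theorems.  [15] = [Balaban1985Variational]; [6] = [Balaban1985RegularSpaces];
[3] = [Balaban1985Averaging]; [I] = [Balaban1987RG1].

WHY.  (1) The (d′) letter of the head token is supplied by `hA1_lam(_free)` (MODULES 117∕117′) from print's cell-form criticality and print's (152) member 2 on the tower; the premise of record
must therefore carry member 2 (the junction `…N07Thm4RecMemberOfRecordCrownSU` pays it from `DatumCrownAt`'s `msup … (−2)` row).  (2) ⚑ LOCATED-NRM-ROW-CURRENCY: 88″'s row 9 (`NrmDbarWideOfRecord`)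
is the one row the N05-REC junction can never pay (first order in the block curvature for the radial tower); under ρ3 the representative's tower is keyed on the averaged contour datum
(`symCd`), row 9′ := `NrmSymOfRecord`, and the dbar∕sheared-frame mismatch becomes the ε²-type φ-letter of the (L1″) bridge (`…N07DbarFrameTowerBridge`) on the chart side.
(3) (Q-φ) = φ-a (plan g93 WORD (j-iv) protocol): row 9′ is keyed at the premise's OWN ∃-bound `u` — the SAME `u` that carries rows 1–8 and (T2b) (one surface); the chart side
consumes no `g_sr` transport defect (93′ needs `R̄(um) = 1` exactly on the cells for THIS `u`; the only φ is the (L1″) frame letter); the transport is paid junction-side as `κ += C`.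

WHAT IS DECLARED ∕ PROVED (sorry-free; axioms standard).
* §1 `HThm4RecSym152 F N Mc ρ κ a₀ : Prop` (rows 1–8 of 88″ ∧ (T2b) ∧ `NrmSymOfRecord … u A`); `hThm4RecSym152_mono` (monotone in `κ`, antitone in `a₀`).
* §2 ★★★ `hS3NORMSym152_of_hThm4RecSym152` — THE DOOR: the HS3NORM clause of the 152-edition of the knit (77c⁗: 77c's binder + (T2b)) at `Nrm := NrmSymOfRecord F N Mc ρ`, from the premise
  and the guard's conjuncts — MODULE 88″'s door byte for byte plus one conjunct and the currency letter.
* §3 A6: ★ `nrmSymOfRecord_one` (`NrmSymOfRecord … 1 j idx 1 A`: `w := 1`, the unit field is `symCd`-axial by 86 `axialGauge_symContourData_one` + `federbushSU_const`, unit block averages by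
  `gaugeAvgIter_loopAvgBlockOp_one`), ★ `hThm4RecSym152_conclusion_at_one` (the ∃-conclusion inhabited at `U := 1`, `u := 1`, `A := 0`).
HONEST LABEL (binding).  `HThm4RecSym152` is a CONDITIONAL premise (print-licensed [I] pp. 253–254 for the (0.4)∕(0.11) structure, NOT print-proved for it; N05-REC's road + the junction's
(j-i)–(j-iii) re-key); this file DISCHARGES NOTHING of it; with it the knit of record is CONDITIONAL; K0⁷ ∕ K1⁹ NOT closed; N07 ∕ N05 NOT discharged; counts unmoved (typed 28∕28 · discharged
8∕27); one finite 𝕋⁴ programme at fixed ε — the route closes the conditional finite-𝕋⁴ rung `BalabanLadder.UV` ONLY; the YM mass gap (Clay) is NOT proved by any of this; nothing continuum ∕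
ℝ⁴ ∕ OS.  ONE `def`, no `instance`, no `notation`, no `sorry`.

References: [6] Thm. 4 p. 88, Prop. 6 (1.130)–(1.138) p. 99, (1.29) p. 81, (1.15) p. 78; [15] (144) p. 300, (147)–(153) p. 301; [3] (78)–(81) p. 30; [I] (0.4)–(0.11) pp. 253–254.
-/

set_option autoImplicit false

noncomputable section
open scoped BigOperators Matrix.Norms.L2Operator

namespace Summit.QuantumFields.YangMills.BalabanUVNodes.N07Thm4RecordStructureSym152

open Literature.MathematicalPhysics.QuantumFieldTheory.Balaban1983to89
open Literature.MathematicalPhysics.QuantumFieldTheory.Balaban1983to89.Node00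
open Literature.MathematicalPhysics.QuantumFieldTheory.Balaban1983to89.B15DeterminingSets
open Literature.MathematicalPhysics.QuantumFieldTheory.Balaban1983to89.B12RegularSpaces111 (gaugeU expI grad)
open B15Eq112TorusCover (cover)
open B14DomainGeom (Pt Within)
open B8Eq131Cubes (sqLo sqHi box cube)
open B5Eq118OneStroke (iterBlockOf)
open B6SectADomainsV1 (Domains)
open B6SectAOperatorsV1 (BondIdx RE dsE QpE)
open Literature.MathematicalPhysics.QuantumFieldTheory.BalabanImbrieJaffe1984to88.BIJ85AxialPropagator411 (BondSpace)
open T4Continuum (T4Family)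
open Summit.QuantumFields.YangMills.BalabanUVNodes.N07NormalisationSymOfRecord (NrmSymOfRecord symCd)
open Summit.QuantumFields.YangMills.BalabanUVNodes.N07DatumGauge152Guarded (two_mul_pow_le_sitesPerDir_of_levelGuard)
open Summit.QuantumFields.YangMills.BalabanUVNodes.N07Thm4RecordStructure (axialGaugeAt_one gaugeAct_one_one)
open Summit.QuantumFields.YangMills.BalabanUVNodes.N07SymContourData (axialGauge_symContourData_one)
open T4AxialGaugeRooted (axialGaugeAt)
open B15Eq177GaugeInvariance (blockLift)
open B12GaugeOrbits021 (IsResidual)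
open GaugeField (gaugeAct)
open ExpMeanLog (expMeanLogSU)
open B8Eq131Cubes (tLo tHi ctr)

variable (F : T4Family) (N : ℕ) [NeZero N]

/-! ## §1  The named premise, (152)-complete on the tower -/

/-- **`HThm4RecSym152` — [6] THEOREM 4 ∕ PROPOSITION 6 WITH [15] (152)–(153) (FIRST AND SECOND MEMBER OF (152) ON THE WHOLE TOWER) AND «ū_j = 1 ON Λ′_j» FOR THE RECORD's AVERAGING
STRUCTURE, AT EVERY MEETING DATUM OF A SEPARATED RUN**: MODULE 88″'s `HThm4RecDbar F N Mc ρ κ a₀` rows 1–8 VERBATIM, with ONE conjunct added after the tower's sup letters — print's (152) second member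
`(L^{j′}η)²|∇^ηA| < κ·ε_j` on every `□_{j′}`, `j′ ≤ j`, in the currency of the box gradient row: `‖∇^η_νA_μ(x)‖ < κ·ε_j·L^{2(j−j′)}` on the derivative stencils of `π″□_{j′}` — and row 9′ := MODULE 87's `NrmSymOfRecord … u A` (ρ3).  A displayed
premise, NEVER asserted (print-licensed [I] pp. 253–254 for the (0.4)∕(0.11) structure, NOT print-proved for it). [cite: Balaban1985RegularSpaces, Thm. 4 p.88, Prop. 6 (1.130)–(1.138) p.99, (1.29) p.81; Balaban1985Variational, (147)–(153) p.301; Balaban1985Averaging, (78)–(81) p.30; Balaban1987RG1, (0.4)–(0.9) pp.253–254] -/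
def HThm4RecSym152 (Mc ρ : ℕ) (κ a₀ : ℝ) : Prop :=
  0 < κ → ∀ (ν : Stage7Numerics) (M : ℕ) (g : ℕ → ℝ) (K k : ℕ) (s : SeqOfRecord F ν M g K k), Sect2.SeqSeparated ν.M₁ s → 0 < ν.M₁ →
    (11 * 4 + 4 * ρ + Mc + 3) * F.L ≤ ν.M₁ → Mc + 11 * 4 + 6 * ρ ≤ (F.P K).sitesPerDir k → 1 ≤ k →
    ∀ (ε : ℕ → ℝ), (∀ n, n ≤ k → 0 < ε n ∧ ε n ≤ a₀) → (∀ n, n < k → ε n ≤ 2 * ε (n + 1)) →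
    ∀ U : GaugeField (F.P K) 0 (SU N),
    (∀ n, n ≤ k → PlaqSmallOn (Sect2.omegaPlaqsTop s.Ω (suppDomOfRecord F ν K s.Ω) n) (ε n * (F.P K).eta n ^ 2) U) →
    (∀ n, n ≤ k → Sect2.CoDivSmallOn (Sect2.omegaBondsTop s.Ω (suppDomOfRecord F ν K s.Ω) n) (ε n * (F.P K).eta n ^ 3) U) →
    ∀ (j : ℕ) (hk : j ≤ (F.P K).m + (F.P K).K), 1 ≤ j → j ≤ k → ∀ (idx : Pt (F.P K).d),
    (∃ x ∈ box (F.P K).L (cornerP (F.P K) Mc ρ idx) (sideP (F.P K) Mc ρ) j, ∃ y : Pt (F.P K).d, cover (F.P K) y ∈ s.Ω j ∧ Within ((3 : ℕ) : ℤ) x y) →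
    ∃ (u : GaugeTransf (F.P K) 0 (SU N)) (A : PBond (F.P K) 0 → MatA N),
      (∀ b ∈ (Sect2.regionOfSet (F.P K) (cover (F.P K) '' box (F.P K).L (cornerP (F.P K) Mc ρ idx) (sideP (F.P K) Mc ρ) j)).bonds,
        gaugeU (fun x => ιSU N (u x)) (fun b' => ιSU N (U b')) b = expI ((F.P K).eta j) (A b)) ∧
      (∀ b ∈ (Sect2.regionOfSet (F.P K) (cover (F.P K) '' cube (F.P K).L (cornerP (F.P K) Mc ρ idx) (sideP (F.P K) Mc ρ) ρ j 0)).bonds,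
        gaugeU (fun x => ιSU N (u x)) (fun b' => ιSU N (U b')) b = expI ((F.P K).eta j) (A b)) ∧
      (∀ j', j' ≤ j →
        ∀ b ∈ (Sect2.regionOfSet (F.P K) (cover (F.P K) '' cube (F.P K).L (cornerP (F.P K) Mc ρ idx) (sideP (F.P K) Mc ρ) ρ j j')).bonds,
          ‖A b‖ < κ * ε j * ((F.P K).L : ℝ) ^ (j - j')) ∧
      -- ★ (T2b): print's (152) SECOND member on the tower
      (∀ j', j' ≤ j →
        ∀ q ∈ (Sect2.regionOfSet (F.P K) (cover (F.P K) '' cube (F.P K).L (cornerP (F.P K) Mc ρ idx) (sideP (F.P K) Mc ρ) ρ j j')).dpairs,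
          ‖grad ((F.P K).eta j) q.2.1 (fun y => A ⟨y, q.2.2⟩) q.1‖ < κ * ε j * ((F.P K).L : ℝ) ^ (2 * (j - j'))) ∧
      (∀ b ∈ (Sect2.regionOfSet (F.P K) (cover (F.P K) '' box (F.P K).L (cornerP (F.P K) Mc ρ idx) (sideP (F.P K) Mc ρ) j)).bonds,
        ‖A b‖ < κ * ε j) ∧
      (∀ q ∈ (Sect2.regionOfSet (F.P K) (cover (F.P K) '' box (F.P K).L (cornerP (F.P K) Mc ρ idx) (sideP (F.P K) Mc ρ) j)).dpairs,
        ‖grad ((F.P K).eta j) q.2.1 (fun y => A ⟨y, q.2.2⟩) q.1‖ < κ * ε j) ∧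
      (∀ b ∈ Sect2.bondsDeep (cover (F.P K) '' box (F.P K).L (cornerP (F.P K) Mc ρ idx) (sideP (F.P K) Mc ρ) j),
        ‖Sect2.codiffCurlA ((F.P K).eta j) A b.src b.dir‖ < κ * ε j) ∧
      (∀ b ∈ Sect2.bondsDeep (cover (F.P K) '' box (F.P K).L (cornerP (F.P K) Mc ρ idx) (sideP (F.P K) Mc ρ) j),
        ‖∑ ν' : Fin (F.P K).d, (((F.P K).eta j : ℝ) : ℂ)⁻¹ •
            (grad ((F.P K).eta j) ν' (fun y => A ⟨y, b.dir⟩) (b.src.unshift ν') - grad ((F.P K).eta j) ν' (fun y => A ⟨y, b.dir⟩) b.src)‖ < κ * ε j) ∧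
      (∀ φ : MatA N →L[ℂ] ℂ,
        RE (domainsMeet (cubeDomains (F.P K) (cornerP (F.P K) Mc ρ idx) (sideP (F.P K) Mc ρ) ρ j hk) (domainsOfSeq s.Ω j hk)) ((F.P K).eta j)⁻¹
            (dsE ((F.P K).eta j)⁻¹ (WithLp.toLp 2 fun b => (φ (A b)).re : BondSpace (F.P K))) = 0 ∧
        RE (domainsMeet (cubeDomains (F.P K) (cornerP (F.P K) Mc ρ idx) (sideP (F.P K) Mc ρ) ρ j hk) (domainsOfSeq s.Ω j hk)) ((F.P K).eta j)⁻¹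
            (dsE ((F.P K).eta j)⁻¹ (WithLp.toLp 2 fun b => (φ (A b)).im : BondSpace (F.P K))) = 0) ∧
      NrmSymOfRecord F N Mc ρ ν M g K k s U j idx u A

variable {F N}

/-- **MONOTONICITY OF THE 152-EDITION**: for `0 < κ ≤ κ′` and `a₀′ ≤ a₀`, `HThm4RecSym152 F N Mc ρ κ a₀ → HThm4RecSym152 F N Mc ρ κ′ a₀′`.
[cite: Balaban1985RegularSpaces, Prop. 6 p.99; Balaban1985Variational, (152) p.301] -/
theorem hThm4RecSym152_mono {Mc ρ : ℕ} {κ κ' a₀ a₀' : ℝ} (h0 : 0 < κ) (hκ : κ ≤ κ') (ha : a₀' ≤ a₀) (h : HThm4RecSym152 F N Mc ρ κ a₀) :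
    HThm4RecSym152 F N Mc ρ κ' a₀' := by
  intro _ ν M g K k s hsep hM₁ hfl hnw hk ε hε hcomp U h17 h19 j hk' hj1 hjk idx hmeet
  have hε' : ∀ n, n ≤ k → 0 < ε n ∧ ε n ≤ a₀ := fun n hn => ⟨(hε n hn).1, (hε n hn).2.trans ha⟩
  obtain ⟨u, A, h1, hT1, hT2, hT2b, h2, h3, h4, h5, h6, hN⟩ :=
    h h0 ν M g K k s hsep hM₁ hfl hnw hk ε hε' hcomp U h17 h19 j hk' hj1 hjk idx hmeet
  have hεj : 0 ≤ ε j := (hε j hjk).1.le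
  have hκε : κ * ε j ≤ κ' * ε j := mul_le_mul_of_nonneg_right hκ hεj
  refine ⟨u, A, h1, hT1, ?_, ?_, ?_, ?_, ?_, ?_, h6, hN⟩
  · intro j' hj' b hb
    exact (hT2 j' hj' b hb).trans_le (mul_le_mul_of_nonneg_right hκε (pow_nonneg (Nat.cast_nonneg _) _))
  · intro j' hj' q hq
    exact (hT2b j' hj' q hq).trans_le (mul_le_mul_of_nonneg_right hκε (pow_nonneg (Nat.cast_nonneg _) _))
  · intro b hb; exact (h2 b hb).trans_le hκε
  · intro q hq; exact (h3 q hq).trans_le hκε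
  · intro b hb; exact (h4 b hb).trans_le hκε
  · intro b hb; exact (h5 b hb).trans_le hκε

/-! ## §2  The door: the (152)-complete HS3NORM clause at `Nrm := NrmSymOfRecord` -/

variable (F N)

/-- ★★★ **THE CONDITIONAL DOOR S1ᶜ, (152)-COMPLETE**: from `HThm4RecSym152 F N Mc ρ κ a₀` and the knit's guard implication `Adm … → c ≤ ν.M₁ ∧ k + c₀ ≤ F.m + K` with the side conditions
`(11·4 + 4ρ + Mc + 3)·L ≤ c`, `Mc + 11·4 + 6ρ ≤ 2·L^{c₀}`, `0 < B₃`, `0 < κ` — the HS3NORM-67c clause of the knit AT `Nrm := NrmSymOfRecord F N Mc ρ` WITH (T2b) after the tower's sup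
letters (the HS3NORM binder of the 152-edition of the knit).  MODULE 88″'s door byte for byte, plus the one conjunct; the (153) rows are extended to every `D′` with
`ker Q′_{D′} ≤ ker Q′_{D″}` as there. [cite: Balaban1985Variational, (144) p.300, (147)–(153) p.301; Balaban1985RegularSpaces, Prop. 6 p.99, Thm. 4 p.88, (1.29) p.81; Balaban1987RG1, (0.1) p.251, (0.4) p.253] -/
theorem hS3NORMSym152_of_hThm4RecSym152 {ρ Mc : ℕ} {c c₀ : ℕ} (hc : (11 * 4 + 4 * ρ + Mc + 3) * F.L ≤ c) (hc₀ : Mc + 11 * 4 + 6 * ρ ≤ 2 * F.L ^ c₀)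
    (Adm : StepGuard F) (hAdm : ∀ (ν : Stage7Numerics) (M : ℕ) (g : ℕ → ℝ) (K k : ℕ) (s : SeqOfRecord F ν M g K k), Adm ν M g K k s → c ≤ ν.M₁ ∧ k + c₀ ≤ F.m + K)
    {B₃ κ a₀ a₁ : ℝ} (hB₃ : 0 < B₃) (hκ : 0 < κ) (hT : HThm4RecSym152 F N Mc ρ κ a₀) :
    ∀ (ν : Stage7Numerics) (M : ℕ) (g : ℕ → ℝ) (K k : ℕ) (s : SeqOfRecord F ν M g K k), Sect2.SeqSeparated ν.M₁ s → 0 < ν.M₁ →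
      Adm ν M g K k s → 1 ≤ k →
      ∀ (ε δ : ℕ → ℝ),
      (∀ n, n ≤ k → 0 < δ n ∧ δ n ≤ a₁) → (∀ n, n < k → δ n ≤ 2 * δ (n + 1)) → (∀ n, n < k → δ (n + 1) ≤ 2 * δ n) →
      (∀ n, n ≤ k → B₃ * δ n ≤ ε n ∧ ε n ≤ a₀) → (∀ n, n < k → ε n ≤ 2 * ε (n + 1)) → (∀ n, n < k → ε (n + 1) ≤ 2 * ε n) →
      ∀ W : MSField (F.P K) (SU N), Sect2.DataSmall7PTop (avOfRecord F N K) s.Ω (suppDomOfRecord F ν K s.Ω) k δ W →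
      ∀ U : GaugeField (F.P K) 0 (SU N),
      (∀ n, n ≤ k → PlaqSmallOn (Sect2.omegaPlaqsTop s.Ω (suppDomOfRecord F ν K s.Ω) n) (ε n * (F.P K).eta n ^ 2) U) →
      (∀ n, n ≤ k → Sect2.CoDivSmallOn (Sect2.omegaBondsTop s.Ω (suppDomOfRecord F ν K s.Ω) n) (ε n * (F.P K).eta n ^ 3) U) →
      AgreeOn (genSet s.Ω k) (avgFamily (avOfRecord F N K) U) W → IsCritOnFibre F N K (genSet s.Ω k) W U →
      ∀ (n : ℕ) (hk : K - n ≤ (F.P K).m + (F.P K).K), 1 ≤ K - n → K - n ≤ k → ∀ (idx : Pt (F.P K).d),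
      (∃ x ∈ box (F.P K).L (cornerP (F.P K) Mc ρ idx) (sideP (F.P K) Mc ρ) (K - n), ∃ y : Pt (F.P K).d, cover (F.P K) y ∈ s.Ω (K - n) ∧ Within ((3 : ℕ) : ℤ) x y) →
      (K - n = k ∨ ∀ z ∈ box (F.P K).L (cornerP (F.P K) Mc ρ idx - ((2 * ρ : ℕ) : Pt (F.P K).d)) (sideP (F.P K) Mc ρ + 2 * (2 * ρ)) (K - n),
        cover (F.P K) z ∉ s.Ω (K - n + 1)) →
      ∃ (u : GaugeTransf (F.P K) 0 (SU N)) (A : PBond (F.P K) 0 → MatA N),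
      (∀ b ∈ (Sect2.regionOfSet (F.P K) (cover (F.P K) '' box (F.P K).L (cornerP (F.P K) Mc ρ idx) (sideP (F.P K) Mc ρ) (K - n))).bonds,
        gaugeU (fun x => ιSU N (u x)) (fun b' => ιSU N (U b')) b = expI ((F.P K).eta (K - n)) (A b)) ∧
      (∀ b ∈ (Sect2.regionOfSet (F.P K) (cover (F.P K) '' cube (F.P K).L (cornerP (F.P K) Mc ρ idx) (sideP (F.P K) Mc ρ) ρ (K - n) 0)).bonds,
        gaugeU (fun x => ιSU N (u x)) (fun b' => ιSU N (U b')) b = expI ((F.P K).eta (K - n)) (A b)) ∧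
      (∀ j', j' ≤ K - n →
        ∀ b ∈ (Sect2.regionOfSet (F.P K) (cover (F.P K) '' cube (F.P K).L (cornerP (F.P K) Mc ρ idx) (sideP (F.P K) Mc ρ) ρ (K - n) j')).bonds,
          ‖A b‖ < κ * ε (K - n) * ((F.P K).L : ℝ) ^ (K - n - j')) ∧
      (∀ j', j' ≤ K - n →
        ∀ q ∈ (Sect2.regionOfSet (F.P K) (cover (F.P K) '' cube (F.P K).L (cornerP (F.P K) Mc ρ idx) (sideP (F.P K) Mc ρ) ρ (K - n) j')).dpairs,
          ‖grad ((F.P K).eta (K - n)) q.2.1 (fun y => A ⟨y, q.2.2⟩) q.1‖ < κ * ε (K - n) * ((F.P K).L : ℝ) ^ (2 * (K - n - j'))) ∧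
      (∀ b ∈ (Sect2.regionOfSet (F.P K) (cover (F.P K) '' box (F.P K).L (cornerP (F.P K) Mc ρ idx) (sideP (F.P K) Mc ρ) (K - n))).bonds,
        ‖A b‖ < κ * ε (K - n)) ∧
      (∀ q ∈ (Sect2.regionOfSet (F.P K) (cover (F.P K) '' box (F.P K).L (cornerP (F.P K) Mc ρ idx) (sideP (F.P K) Mc ρ) (K - n))).dpairs,
        ‖grad ((F.P K).eta (K - n)) q.2.1 (fun y => A ⟨y, q.2.2⟩) q.1‖ < κ * ε (K - n)) ∧
      (∀ b ∈ Sect2.bondsDeep (cover (F.P K) '' box (F.P K).L (cornerP (F.P K) Mc ρ idx) (sideP (F.P K) Mc ρ) (K - n)),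
        ‖Sect2.codiffCurlA ((F.P K).eta (K - n)) A b.src b.dir‖ < κ * ε (K - n)) ∧
      (∀ b ∈ Sect2.bondsDeep (cover (F.P K) '' box (F.P K).L (cornerP (F.P K) Mc ρ idx) (sideP (F.P K) Mc ρ) (K - n)),
        ‖∑ ν' : Fin (F.P K).d, (((F.P K).eta (K - n) : ℝ) : ℂ)⁻¹ •
            (grad ((F.P K).eta (K - n)) ν' (fun y => A ⟨y, b.dir⟩) (b.src.unshift ν') - grad ((F.P K).eta (K - n)) ν' (fun y => A ⟨y, b.dir⟩) b.src)‖ <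
          κ * ε (K - n)) ∧
      (∀ D' : Domains (F.P K), LinearMap.ker (QpE D') ≤
          LinearMap.ker (QpE (domainsMeet (cubeDomains (F.P K) (cornerP (F.P K) Mc ρ idx) (sideP (F.P K) Mc ρ) ρ (K - n) hk) (domainsOfSeq s.Ω (K - n) hk))) →
        ∀ φ : MatA N →L[ℂ] ℂ,
        RE D' ((F.P K).eta (K - n))⁻¹ (dsE ((F.P K).eta (K - n))⁻¹ (WithLp.toLp 2 fun b => (φ (A b)).re : BondSpace (F.P K))) = 0 ∧
        RE D' ((F.P K).eta (K - n))⁻¹ (dsE ((F.P K).eta (K - n))⁻¹ (WithLp.toLp 2 fun b => (φ (A b)).im : BondSpace (F.P K))) = 0) ∧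
      NrmSymOfRecord F N Mc ρ ν M g K k s U (K - n) idx u A := by
  intro ν M g K k s hsep hM₁ hadm hk1 ε δ hδ _ _ hεr hcomp _ W _ U h17 h19 _ _ n hk hn1 hnk idx hdat _
  obtain ⟨hcν, hlevF⟩ := hAdm ν M g K k s hadm
  have hfl : (11 * 4 + 4 * ρ + Mc + 3) * F.L ≤ ν.M₁ := hc.trans hcν
  have hlevP : k + c₀ ≤ (F.P K).m + (F.P K).K := by rw [T4Family.P_m, T4Family.P_K]; exact hlevF
  have hlev : Mc + 11 * 4 + 6 * ρ ≤ (F.P K).sitesPerDir k := by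
    refine hc₀.trans ?_
    have := two_mul_pow_le_sitesPerDir_of_levelGuard (P := F.P K) le_rfl hlevP
    rwa [T4Family.P_L] at this
  have hε : ∀ m, m ≤ k → 0 < ε m ∧ ε m ≤ a₀ := fun m hm =>
    ⟨lt_of_lt_of_le (mul_pos hB₃ (hδ m hm).1) (hεr m hm).1, (hεr m hm).2⟩
  obtain ⟨u, A, h1, hT1, hT2, hT2b, h2, h3, h4, h5, h6, hN⟩ := hT hκ ν M g K k s hsep hM₁ hfl hlev hk1 ε hε hcomp U h17 h19 (K - n) hk hn1 hnk idx hdat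
  exact ⟨u, A, h1, hT1, hT2, hT2b, h2, h3, h4, h5, fun D' hD' φ => ⟨RE_eq_zero_of_ker_le hD' (h6 φ).1, RE_eq_zero_of_ker_le hD' (h6 φ).2⟩, hN⟩

/-! ## §3  A6 certificate: the premise's conclusion is inhabited at the trivial field -/

variable {F N}

/-- ★ **A6 CERTIFICATE FOR `NrmSymOfRecord` AT THE TRIVIAL FIELD**: `NrmSymOfRecord F N Mc ρ ν M g K k s 1 j idx 1 A` holds (witness `w := 1`: residual; `M^i(1) = 1` is `symCd`-axial by
MODULE 86's `axialGauge_symContourData_one` with `federbushSU_const`; the top axial gauge of `M^j(1) = 1` is `1`, and `R̄^{j′}1 = 1`). [cite: Balaban1987RG1, (0.11) p.253; Balaban1985Averaging, (79)–(81) p.30 (bookkeeping)] -/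
theorem nrmSymOfRecord_one (Mc ρ : ℕ) (ν : Stage7Numerics) (M : ℕ) (g : ℕ → ℝ) (K k : ℕ) (s : SeqOfRecord F ν M g K k) (j : ℕ) (idx : Pt (F.P K).d)
    (A : PBond (F.P K) 0 → MatA N) :
    NrmSymOfRecord F N Mc ρ ν M g K k s (1 : GaugeField (F.P K) 0 (SU N)) j idx (fun _ => 1 : GaugeTransf (F.P K) 0 (SU N)) A := by
  refine ⟨fun _ => 1, fun _ => rfl, fun i _ => ?_, fun hk j' _ y _ => ?_⟩
  · rw [gaugeAct_one_one, B15Claim189UnitTestAtRecord.iter_avOfRecord_one]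
    exact axialGauge_symContourData_one _ (FederbushMean.federbushSU_const 1)
  · have hfun : (fun x : Site (F.P K) 0 => blockLift j (axialGaugeAt (Averaging.iter (avOfRecord F N K) j
        (gaugeAct (fun _ => 1 : GaugeTransf (F.P K) 0 (SU N)) (1 : GaugeField (F.P K) 0 (SU N))))
          (tLo (cornerP (F.P K) Mc ρ idx) ρ) (tHi (cornerP (F.P K) Mc ρ idx) (sideP (F.P K) Mc ρ) ρ) (ctr (cornerP (F.P K) Mc ρ idx) (sideP (F.P K) Mc ρ))) x *
          (fun _ => 1 : GaugeTransf (F.P K) 0 (SU N)) x * ((fun _ => 1 : GaugeTransf (F.P K) 0 (SU N)) x)⁻¹) = fun _ => 1 := by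
      funext x
      rw [gaugeAct_one_one, B15Claim189UnitTestAtRecord.iter_avOfRecord_one, axialGaugeAt_one]
      simp [blockLift]
    rw [hfun, gaugeAvgIter_loopAvgBlockOp_one expMeanLogSU (expMeanLogSU_E_one' N) j']

/-- ★ **A6 CERTIFICATE FOR `HThm4RecSym152`'s CONCLUSION AT THE TRIVIAL FIELD**: for `κ > 0`, `ε_j > 0`, every run and every datum, the ∃-clause of `HThm4RecSym152` at `U := 1` holds with
`u := 1`, `A := 0` — MODULE 88″'s certificate shape: every gauge row `1 = e^0`, every letter row `‖0‖ < …`, the (T2b) row `‖∇^η_ν 0‖ = 0`, the (153) rows linear at `0`, and `nrmSymOfRecord_one`.  (The premise itself is NOT proved by this.)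
[cite: Balaban1985Variational, (152)–(153) p.301 (bookkeeping); Balaban1985RegularSpaces, (1.38) p.82] -/
theorem hThm4RecSym152_conclusion_at_one (Mc ρ : ℕ) {κ : ℝ} (hκ : 0 < κ) (ν : Stage7Numerics) (M : ℕ) (g : ℕ → ℝ) (K k : ℕ) (s : SeqOfRecord F ν M g K k)
    {ε : ℕ → ℝ} (j : ℕ) (hk : j ≤ (F.P K).m + (F.P K).K) (idx : Pt (F.P K).d) (hε : 0 < ε j) :
    ∃ (u : GaugeTransf (F.P K) 0 (SU N)) (A : PBond (F.P K) 0 → MatA N),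
      (∀ b ∈ (Sect2.regionOfSet (F.P K) (cover (F.P K) '' box (F.P K).L (cornerP (F.P K) Mc ρ idx) (sideP (F.P K) Mc ρ) j)).bonds,
        gaugeU (fun x => ιSU N (u x)) (fun b' => ιSU N ((1 : GaugeField (F.P K) 0 (SU N)) b')) b = expI ((F.P K).eta j) (A b)) ∧
      (∀ b ∈ (Sect2.regionOfSet (F.P K) (cover (F.P K) '' cube (F.P K).L (cornerP (F.P K) Mc ρ idx) (sideP (F.P K) Mc ρ) ρ j 0)).bonds,
        gaugeU (fun x => ιSU N (u x)) (fun b' => ιSU N ((1 : GaugeField (F.P K) 0 (SU N)) b')) b = expI ((F.P K).eta j) (A b)) ∧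
      (∀ j', j' ≤ j →
        ∀ b ∈ (Sect2.regionOfSet (F.P K) (cover (F.P K) '' cube (F.P K).L (cornerP (F.P K) Mc ρ idx) (sideP (F.P K) Mc ρ) ρ j j')).bonds,
          ‖A b‖ < κ * ε j * ((F.P K).L : ℝ) ^ (j - j')) ∧
      (∀ j', j' ≤ j →
        ∀ q ∈ (Sect2.regionOfSet (F.P K) (cover (F.P K) '' cube (F.P K).L (cornerP (F.P K) Mc ρ idx) (sideP (F.P K) Mc ρ) ρ j j')).dpairs,
          ‖grad ((F.P K).eta j) q.2.1 (fun y => A ⟨y, q.2.2⟩) q.1‖ < κ * ε j * ((F.P K).L : ℝ) ^ (2 * (j - j'))) ∧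
      (∀ b ∈ (Sect2.regionOfSet (F.P K) (cover (F.P K) '' box (F.P K).L (cornerP (F.P K) Mc ρ idx) (sideP (F.P K) Mc ρ) j)).bonds,
        ‖A b‖ < κ * ε j) ∧
      (∀ q ∈ (Sect2.regionOfSet (F.P K) (cover (F.P K) '' box (F.P K).L (cornerP (F.P K) Mc ρ idx) (sideP (F.P K) Mc ρ) j)).dpairs,
        ‖grad ((F.P K).eta j) q.2.1 (fun y => A ⟨y, q.2.2⟩) q.1‖ < κ * ε j) ∧
      (∀ b ∈ Sect2.bondsDeep (cover (F.P K) '' box (F.P K).L (cornerP (F.P K) Mc ρ idx) (sideP (F.P K) Mc ρ) j),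
        ‖Sect2.codiffCurlA ((F.P K).eta j) A b.src b.dir‖ < κ * ε j) ∧
      (∀ b ∈ Sect2.bondsDeep (cover (F.P K) '' box (F.P K).L (cornerP (F.P K) Mc ρ idx) (sideP (F.P K) Mc ρ) j),
        ‖∑ ν' : Fin (F.P K).d, (((F.P K).eta j : ℝ) : ℂ)⁻¹ •
            (grad ((F.P K).eta j) ν' (fun y => A ⟨y, b.dir⟩) (b.src.unshift ν') - grad ((F.P K).eta j) ν' (fun y => A ⟨y, b.dir⟩) b.src)‖ < κ * ε j) ∧
      (∀ φ : MatA N →L[ℂ] ℂ,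
        RE (domainsMeet (cubeDomains (F.P K) (cornerP (F.P K) Mc ρ idx) (sideP (F.P K) Mc ρ) ρ j hk) (domainsOfSeq s.Ω j hk)) ((F.P K).eta j)⁻¹
            (dsE ((F.P K).eta j)⁻¹ (WithLp.toLp 2 fun b => (φ (A b)).re : BondSpace (F.P K))) = 0 ∧
        RE (domainsMeet (cubeDomains (F.P K) (cornerP (F.P K) Mc ρ idx) (sideP (F.P K) Mc ρ) ρ j hk) (domainsOfSeq s.Ω j hk)) ((F.P K).eta j)⁻¹
            (dsE ((F.P K).eta j)⁻¹ (WithLp.toLp 2 fun b => (φ (A b)).im : BondSpace (F.P K))) = 0) ∧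
      NrmSymOfRecord F N Mc ρ ν M g K k s (1 : GaugeField (F.P K) 0 (SU N)) j idx u A := by
  refine ⟨fun _ => 1, 0, ?_, ?_, ?_, ?_, ?_, ?_, ?_, ?_, ?_, nrmSymOfRecord_one Mc ρ ν M g K k s j idx 0⟩
  · intro b _
    rw [Pi.zero_apply, B12RegularSpaces111Mono.expI_zero]
    show ιSU N 1 * ιSU N 1 * (ιSU N 1)⁻¹ = 1
    simp
  · intro b _
    rw [Pi.zero_apply, B12RegularSpaces111Mono.expI_zero]
    show ιSU N 1 * ιSU N 1 * (ιSU N 1)⁻¹ = 1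
    simp
  · intro j' _ b _; simpa using mul_pos (mul_pos hκ hε) (pow_pos (Nat.cast_pos.2 (F.P K).L_pos) (j - j'))
  · intro j' _ q _
    have : grad ((F.P K).eta j) q.2.1 (fun y => (0 : PBond (F.P K) 0 → MatA N) ⟨y, q.2.2⟩) q.1 = 0 := by simp [grad]
    rw [this, norm_zero]; exact mul_pos (mul_pos hκ hε) (pow_pos (Nat.cast_pos.2 (F.P K).L_pos) _)
  · intro b _; simpa using mul_pos hκ hε
  · intro q _
    have : grad ((F.P K).eta j) q.2.1 (fun y => (0 : PBond (F.P K) 0 → MatA N) ⟨y, q.2.2⟩) q.1 = 0 := by simp [grad]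
    rw [this, norm_zero]; exact mul_pos hκ hε
  · intro b _
    have : Sect2.codiffCurlA ((F.P K).eta j) (0 : PBond (F.P K) 0 → MatA N) b.src b.dir = 0 := by simp [Sect2.codiffCurlA, Sect2.curlA, grad]
    rw [this, norm_zero]; exact mul_pos hκ hε
  · intro b _
    have : ∀ ν' : Fin (F.P K).d, (((F.P K).eta j : ℝ) : ℂ)⁻¹ •
        (grad ((F.P K).eta j) ν' (fun y => (0 : PBond (F.P K) 0 → MatA N) ⟨y, b.dir⟩) (b.src.unshift ν') -
          grad ((F.P K).eta j) ν' (fun y => (0 : PBond (F.P K) 0 → MatA N) ⟨y, b.dir⟩) b.src) = 0 := by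
      intro ν'; simp [grad]
    rw [Finset.sum_eq_zero fun ν' _ => this ν', norm_zero]; exact mul_pos hκ hε
  · intro φ
    have hre : (WithLp.toLp 2 fun b => (φ ((0 : PBond (F.P K) 0 → MatA N) b)).re : BondSpace (F.P K)) = 0 := by ext b; simp
    have him : (WithLp.toLp 2 fun b => (φ ((0 : PBond (F.P K) 0 → MatA N) b)).im : BondSpace (F.P K)) = 0 := by ext b; simp
    rw [hre, him, map_zero, map_zero]
    exact ⟨rfl, rfl⟩

end Summit.QuantumFields.YangMills.BalabanUVNodes.N07Thm4RecordStructureSym152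

end
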